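import Summits.CriticalPhenomena.CardyFormulaZ2.Theses.CardySelfRefinement
import Summits.CriticalPhenomena.CardyFormulaZ2.Theorems.CardySelfRefinementLagHandOffDiscretisable
import HarnessLib

/-!
# `DiscretisationFamilyExists` (stmt-CriticalPhenomena-17656) — every Dobrushin domain carries a `ℤ²` discretisation family

Route `CardySelfRefinement`, sub-problem `CriticalPhenomena/CardyFormulaZ2`.  The item is the six
fields of `ZdDiscretisationFamily D Λ`, unbundled, for some family `Λ : ℝ → DiscreteDobrushin`.
PROOF: the tree theorem `Cruxes.LagHandOff.HittingTournament.stub_discretisable`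
(`Theorems/CardySelfRefinementLagHandOffDiscretisable.lean`) gives, for every Dobrushin domain `D`,
a family `E` with `ZdDiscretisationFamily D E`; its fields are the conjuncts of the item.  (The same
statement for the sibling route `CardySusyWard`, stmt-CriticalPhenomena-9644, is
`Theorems.DiscretisationFamilyExists_proof`; we go through the same-route stub so that this file's
import cone stays inside route `CardySelfRefinement`.)
-/

noncomputable section

open Literature.Probability.LatticeModels Literature.Probability.RandomPlanarGeometry
open Summit.CriticalPhenomena.CardyFormulaZ2.Cruxes.LagHandOff.HittingTournament

namespace Summit.CriticalPhenomena.CardyFormulaZ2.Theorems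

/-- **`DiscretisationFamilyExists`** (route `CardySelfRefinement`): every Dobrushin domain `D`
admits a family `Λ : ℝ → DiscreteDobrushin` with `(Λ δ).Ω = D.carrier`, `(Λ δ).δ = δ`, wired /
dual-wired arcs converging to `(ab)`, `(ba)` and discrete marked points converging to `{a, b}` in
Hausdorff distance, `ℤ²`-admissible for all small `δ > 0`. [folklore; cite: ChelkakSmirnov2012, §3.2] -/
theorem cardySelfRefinement_discretisationFamilyExists_proof :
    Summit.CriticalPhenomena.CardyFormulaZ2.Theses.CardySelfRefinement.DiscretisationFamilyExists := by
  unfold Summit.CriticalPhenomena.CardyFormulaZ2.Theses.CardySelfRefinement.DiscretisationFamilyExists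
  intro D
  obtain ⟨E, hE⟩ := stub_discretisable D
  exact ⟨E, hE.Ω_eq, hE.δ_eq, hE.tendsto_arcA, hE.tendsto_arcB, hE.tendsto_zdABEdges,
    hE.eventually_isZdAdmissible⟩

end Summit.CriticalPhenomena.CardyFormulaZ2.Theorems

end
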